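/-
Origin: expansion seat `planner-pub-hodgecm-pv13-g6-0`, handover #1a 2026-08-18T15:16Z (md5 d77087c89008f0d2be05b07f5a6dcfa2, 381 l., 18 decls; part I of the TREE-SHAPE SPLIT of row #1 a777f951 (SUPERSEDED, never install a777f951); NEW additive leaf; ZERO import rewrites — imports the INSTALLED tree modules HodgeCM.PerL34.GenuineSchrodingerSchwartzDense (RUN 30 row 1f97a611) and HodgeCM.PerL34.GenuineSchrodingerHeisenberg (row 3313bc4a); land AFTER both; HOLD i (`HOME/pub-hodgecm-pv13-g6/lean/Pv13g6/GenuineSchrodingerHeisTranslate.lean`, md5 d77087c8, 381 lines);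
landed by the gen-8 packager in gate run 31 as `HodgeCM/PerL34/GenuineSchrodingerHeisTranslate.lean` (verbatim).
-/
/-
Copyright (c) 2026. All rights reserved.
Released under Apache 2.0 license as described in the file LICENSE.
Authors: unit pub-hodgecm-pv13-g6 (DAG-NODE PROVER #13 gen 6, seam S3, 𝓕-side).

# HodgeCM/PerL34/GenuineSchrodingerHeisTranslate.lean — `𝒮(X)` and the TRANSLATIONS of the adelic
# Heisenberg–Schrödinger representation on `L²(X)`: level saturation, translation stabilisers, the converse,
# the spherical vector, strong continuity of `y ↦ τ_y f`  (part I of three)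
-/
import Summits.HodgeConjecture.HodgeCM.PerL34.GenuineSchrodingerSchwartzDense_2
import Summits.HodgeConjecture.HodgeCM.PerL34.GenuineSchrodingerHeisenberg

/-!
# The Schwartz–Bruhat space `𝒮(X)` through the adelic Heisenberg group, I: translations

`X = Space L = Πʳ_{v split} [(L⁺_v)³, 𝒪_v³]` is the genuine global split Schrödinger space of the
package (`GenuineSchrodingerModel`), `L²(X) = Lp ℂ 2 (μ L)`, `𝒮(X) = Coeff.schwartzBruhat L` the span
of the indicators `1_A` of compact open `A ⊆ X` (pv07-g5 `GenuineSchrodingerSchwartz`; = the locally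
constant compactly supported classes, pv13-g5 `GenuineSchrodingerSchwartzDense`), `B_k = levelBall L k`
the compact open level subgroups (pv13-g5 `GenuineSchrodingerRigid`), `τ_y = translate (μ L) y` and
`M_ξ = modulate (μ L) (heisCharA ψ hψc hψO ξ)` the translations and the adelic Heisenberg modulations
`u ↦ ψ_𝔸(⟨ξ, u⟩) f(u)` (pv13-g5 `GenuineSchrodingerHeisenberg`), for character DATA
`ψ = (ψ_v)_v`, `ψ_v : L⁺_v → U(1)` continuous additive characters with `ψ_v(𝒪_v) = 1` at almost
all `v` (`hψO`).  PROVED HERE, in the kernel and with no further input: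

* §1 `exists_level_saturate` — a compact open `A ⊆ X` is a union of cosets of some `B_k`; hence
  `exists_level_translate_eq`: every `f ∈ 𝒮(X)` is FIXED by `τ(B_k)` for some `k`.
* §2 the converse `mem_schwartzBruhat_of_translate_eq`: a class fixed by `τ(B_k)` and vanishing a.e.
  off a compact set lies in `𝒮(X)` (finite cover by level cosets `D = x + B_k`, `f = ∑_D P_D f`, and the
  per-coset Fubini step `exists_eq_smul_indCO_of_translate_eq : P_D f = c_D • 1_D`, which is the RUN-28
  `exists_eq_indicatorConstLp_of_translate_eq` for the compact open subgroup `B_k` transported by `τ_x`);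
  `mem_schwartzBruhat_iff_translate` states the resulting characterisation
  `𝒮(X) = {f : (∃ k, τ(B_k) f = f) ∧ f compactly supported}`.
* §3 the SPHERICAL VECTOR `exists_eq_smul_indCO_box`: a class supported in `∏_v 𝒪_v³` and fixed by
  `τ(∏_v 𝒪_v³)` is `c • 1_{∏_v 𝒪_v³}` — the distinguished vector of `⊗'_v (L²((L⁺_v)³), 1_{𝒪_v³})` is,
  up to scalars, the unique such vector.
* §4 `continuous_translate_apply`: STRONG CONTINUITY of `y ↦ τ_y f`, `X → L²(X)`, for every `f`
  (locally constant orbit maps on the dense `𝒮(X)` + isometries).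

TREE SHAPE (LEAN-IN-TREE RULE 2026-08-18, `lean/CONVENTIONS.md`: ≤ 400 lines per file).  The material of
this seat's RUN-31 row 1 (891 lines as first handed, md5 a777f951…) is staged as THREE files with byte-identical
declarations: `GenuineSchrodingerHeisTranslate` (§§1–4) → `GenuineSchrodingerHeisModulate` (§§4b–6) →
`GenuineSchrodingerHeisSmooth` (§§7–9; that module name is kept, so `GenuineSchrodingerHeisAdmissible` /
`GenuineSchrodingerHeisFixedDim` import it unchanged).

ABSOLUTE RULE.  Nothing is cited and nothing is posited: every statement is kernel-proved here from the
package's earlier kernel nodes (RUN-28 `LocalFactors.SchrodingerIrreducible`, `SchrodingerLevi`; RUN-30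
pv07-g5 `GenuineSchrodingerSchwartz`, pv13-g5 `GenuineSchrodingerRigid` / `…Heisenberg` / `…SchwartzDense`)
and Mathlib; the only hypotheses are DATA supplied by the caller (the local characters `ψ`, `hψc`, `hψO`).
No PerL / QW8 / 2001-programme statement appears.

Orientation in print (not used as input): the smooth vectors of the Schrödinger representation of a
Heisenberg group over a local field / the adèles form the Schwartz–Bruhat space — A. Weil, *Sur certains
groupes d'opérateurs unitaires*, Acta Math. 111 (1964), Ch. I; C. Mœglin, M.-F. Vignéras,
J.-L. Waldspurger, *Correspondances de Howe sur un corps p-adique*, LNM 1291 (1987), ch. 2, I;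
F. Bruhat, *Distributions sur un groupe localement compact et applications à l'étude des représentations
des groupes p-adiques*, Bull. SMF 89 (1961); restricted products and characters of order `0` at almost
all places: J. Tate, *Fourier analysis in number fields and Hecke's zeta-functions*, in Cassels–Fröhlich,
Algebraic Number Theory (1967).

Namespace `HodgeCM.PerL34.PureTensor.SchrodingerModel.Coeff` (no character data in this part).
-/

set_option autoImplicit false

noncomputable section

open MeasureTheory MeasureTheory.Measure Set Metric Function Complex Topology Filter
open scoped RestrictedProduct InnerProductSpace NNReal ENNReal Pointwise

namespace HodgeCM.PerL34.PureTensor.SchrodingerModel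

open HodgeCM.PerL34.LocalFactors HodgeCM.PerL34.LocalFactors.DilationModel
open HodgeCM.PerL34.LocalFactors.SchrodingerLevi HodgeCM.PerL34.LocalFactors.SchrodingerIrreducible
open HodgeCM.PerL34.IdelePlaces HodgeCM.PerL34.IdelicTorusModel HodgeCM.PerL34.IdelicTorusModel.Genuine
open NumberField IsDedekindDomain

attribute [local instance] LocalFactors.DilationModel.Adic.nontriviallyNormedField
  LocalFactors.DilationModel.Adic.properSpace

variable {L : Type} [Field L] [NumberField L] [IsCMField L]

namespace Coeff

/-! ## §1  Compact open sets are level-saturated; translation stabilisers of `𝒮(X)` -/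

/-- **a compact open subset of `X` is SATURATED by some level ball**: `A + B_k = A`.  (Every point of
`A` has a level coset inside `A`; finitely many of them cover `A`; take the largest level.) -/
theorem exists_level_saturate {A : Set (Space L)} (hA : IsCompact A) (hAo : IsOpen A) :
    ∃ k, ∀ a ∈ A, ∀ y ∈ levelBall L k, a + y ∈ A := by
  classical
  have hex : ∀ x ∈ A, ∃ k, ballCoset L x k ⊆ A := fun x hx => exists_ballCoset_subset (hAo.mem_nhds hx)
  choose! kf hkf using hex
  obtain ⟨t, htA, hcover⟩ :=
    hA.elim_nhds_subcover (fun x => ballCoset L x (kf x)) fun x _ => ballCoset_mem_nhds x (kf x)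
  refine ⟨t.sup kf, fun a ha y hy => ?_⟩
  obtain ⟨x, hxt, hax⟩ := Set.mem_iUnion₂.1 (hcover ha)
  obtain ⟨v, hv, rfl⟩ := hax
  refine hkf x (htA x hxt) ⟨v + y, (levelBall L (kf x)).add_mem hv
    (levelBall_antitone L (Finset.le_sup hxt) hy), ?_⟩
  exact (add_assoc x v y).symm

/-- `τ_y 1_A = 1_A` for `y` in a level ball saturating `A` -/
theorem translate_indCO_of_saturate {A : Set (Space L)} (hA : IsCompact A) (hAo : IsOpen A) {k : ℕ}
    (hk : ∀ a ∈ A, ∀ y ∈ levelBall L k, a + y ∈ A) {y : Space L} (hy : y ∈ levelBall L k) :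
    translate (μ L) y (indCO L A hA hAo) = indCO L A hA hAo := by
  unfold indCO
  rw [translate_indicatorConstLp]
  apply indicatorConstLp_set_congr
  ext u
  simp only [Set.mem_preimage]
  refine ⟨fun h => ?_, fun h => hk u h y hy⟩
  have h' := hk _ h (-y) ((levelBall L k).neg_mem hy)
  rwa [add_neg_cancel_right] at h'

/-- **translation stabilisers**: every `f ∈ 𝒮(X)` is fixed by all `τ_y`, `y ∈ B_k`, for ONE level `k`
(print: a Schwartz–Bruhat function is uniformly locally constant). -/
theorem exists_level_translate_eq {f : Lp ℂ 2 (μ L)} (hf : f ∈ schwartzBruhat L) :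
    ∃ k, ∀ y ∈ levelBall L k, translate (μ L) y f = f := by
  induction hf using Submodule.span_induction with
  | mem f hf =>
    obtain ⟨⟨A, hA, hA'⟩, rfl⟩ := hf
    obtain ⟨k, hk⟩ := exists_level_saturate hA hA'
    exact ⟨k, fun y hy => translate_indCO_of_saturate hA hA' hk hy⟩
  | zero => exact ⟨0, fun y _ => map_zero _⟩
  | add f f' _ _ hf hf' =>
    obtain ⟨k, hk⟩ := hf
    obtain ⟨k', hk'⟩ := hf'
    refine ⟨max k k', fun y hy => ?_⟩
    rw [map_add, hk y (levelBall_antitone L (le_max_left _ _) hy),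
      hk' y (levelBall_antitone L (le_max_right _ _) hy)]
  | smul c f _ hf =>
    obtain ⟨k, hk⟩ := hf
    exact ⟨k, fun y hy => by rw [map_smul, hk y hy]⟩

/-! ## §2  The converse: translation-smooth, compactly supported vectors are Schwartz–Bruhat -/

/-- membership in a level coset: `u ∈ x + B_k ↔ u - x ∈ B_k` -/
theorem mem_ballCoset_iff_sub_mem {x u : Space L} {k : ℕ} : u ∈ ballCoset L x k ↔ u - x ∈ levelBall L k := by
  constructor
  · rintro ⟨v, hv, rfl⟩
    rwa [add_sub_cancel_left]
  · intro h
    exact ⟨u - x, h, add_sub_cancel x u⟩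

/-- two level cosets of the same level with a common point coincide (cosets of the subgroup `B_k`) -/
theorem ballCoset_eq_ballCoset_of_mem_of_mem {x x' u : Space L} {k : ℕ} (hu : u ∈ ballCoset L x k)
    (hu' : u ∈ ballCoset L x' k) : ballCoset L x k = ballCoset L x' k := by
  rw [mem_ballCoset_iff_sub_mem] at hu hu'
  ext w
  rw [mem_ballCoset_iff_sub_mem, mem_ballCoset_iff_sub_mem]
  constructor
  · intro h
    have hw : w - x' = (w - x) - (u - x) + (u - x') := by abel
    rw [hw]
    exact (levelBall L k).add_mem ((levelBall L k).sub_mem h hu) hu'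
  · intro h
    have hw : w - x = (w - x') - (u - x') + (u - x) := by abel
    rw [hw]
    exact (levelBall L k).add_mem ((levelBall L k).sub_mem h hu') hu

/-- a level coset is saturated by its level ball: `{u : u + y ∈ x + B_k} = x + B_k` for `y ∈ B_k` -/
theorem preimage_add_ballCoset {x y : Space L} {k : ℕ} (hy : y ∈ levelBall L k) :
    (fun u : Space L => u + y) ⁻¹' ballCoset L x k = ballCoset L x k := by
  ext u
  rw [Set.mem_preimage, mem_ballCoset_iff_sub_mem, mem_ballCoset_iff_sub_mem, add_sub_right_comm]
  exact ⟨fun h => by simpa using (levelBall L k).sub_mem h hy, fun h => (levelBall L k).add_mem h hy⟩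

/-- proof-irrelevance of the set data of `proj` -/
theorem proj_congr_set {S T : Set (Space L)} (h : S = T) (hS : MeasurableSet S) (hT : MeasurableSet T)
    (f : Lp ℂ 2 (μ L)) : proj (μ L) hS f = proj (μ L) hT f := by
  subst h; rfl

/-- proof-irrelevance of the set data of `indCO` -/
theorem indCO_congr_set {A A' : Set (Space L)} (h : A = A') (hA : IsCompact A) (hAo : IsOpen A)
    (hA' : IsCompact A') (hAo' : IsOpen A') : indCO L A hA hAo = indCO L A' hA' hAo' := by
  subst h; rfl

/-- `τ_a ∘ P_S = P_{S - a} ∘ τ_a`, `S - a = {u : u + a ∈ S}` -/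
theorem translate_proj (a : Space L) {S : Set (Space L)} (hS : MeasurableSet S) (f : Lp ℂ 2 (μ L)) :
    translate (μ L) a (proj (μ L) hS f) =
      proj (μ L) (hS.preimage (measurable_add_const a)) (translate (μ L) a f) := by
  classical
  apply Lp.ext
  have h2 := (measurePreserving_add_right (μ L) a).quasiMeasurePreserving.ae_eq_comp (coeFn_proj (μ L) hS f)
  filter_upwards [coeFn_translate (μ L) a (proj (μ L) hS f), h2,
    coeFn_proj (μ L) (hS.preimage (measurable_add_const a)) (translate (μ L) a f),
    coeFn_translate (μ L) a f] with u e1 e2 e3 e4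
  simp only [Function.comp_apply] at e2
  rw [e1, e2, e3, Set.indicator_apply, Set.indicator_apply, Set.mem_preimage, e4]

/-- the piece `P_D f` of `f` on a level coset `D` is supported in `D` -/
theorem ae_proj_eq_zero {S : Set (Space L)} (hS : MeasurableSet S) (f : Lp ℂ 2 (μ L)) :
    ∀ᵐ u ∂(μ L), u ∉ S → (proj (μ L) hS f : Space L → ℂ) u = 0 :=
  (proj_eq_self_iff (μ L) hS _).1 (proj_proj (μ L) hS f)

/-- **per-coset Fubini step.**  An `L²(X)` class supported in the level coset `x + B_k` and fixed by the
translations `τ_y`, `y ∈ B_k`, is a constant multiple of `1_{x + B_k}` (the RUN-28 Fubini step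
`exists_eq_indicatorConstLp_of_translate_eq` for the compact open subgroup `B_k`, transported by `τ_x`). -/
theorem exists_eq_smul_indCO_of_translate_eq {f : Lp ℂ 2 (μ L)} {k : ℕ} (x : Space L)
    (hτ : ∀ y ∈ levelBall L k, translate (μ L) y f = f)
    (hsupp : ∀ᵐ u ∂(μ L), u ∉ ballCoset L x k → f u = 0) :
    ∃ c : ℂ, f = c • indCO L (ballCoset L x k) (isCompact_ballCoset x k) (isOpen_ballCoset x k) := by
  classical
  have hKo : IsOpen (levelBall L k : Set (Space L)) := isOpen_levelBall L k
  have hKc : IsCompact (levelBall L k : Set (Space L)) := isCompact_levelBall L k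
  -- `g := τ_x f` is `τ(B_k)`-invariant and supported in `B_k`
  have hgτ : ∀ a ∈ levelBall L k, translate (μ L) a (translate (μ L) x f) = translate (μ L) x f :=
    fun a ha => by
    have h := hτ a ha
    rw [SchrodingerLevi.translate_apply] at h
    simp only [SchrodingerLevi.translate_apply]
    rw [translateFun_translateFun, add_comm, ← translateFun_translateFun, h]
  have hgK : proj (μ L) hKo.measurableSet (translate (μ L) x f) = translate (μ L) x f := by
    rw [proj_eq_self_iff]
    have h1 := (measurePreserving_add_right (μ L) x).quasiMeasurePreserving.ae hsupp
    filter_upwards [coeFn_translate (μ L) x f, h1] with u e1 e2 hu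
    rw [e1]
    refine e2 fun hmem => hu ?_
    have h := mem_ballCoset_iff_sub_mem.1 hmem
    rwa [add_sub_cancel_right] at h
  obtain ⟨c, hc⟩ :=
    exists_eq_indicatorConstLp_of_translate_eq (μ L) (levelBall L k) hKo hKc (translate (μ L) x f) hgK hgτ
  refine ⟨c, ?_⟩
  have hback : f = translate (μ L) (-x) (translate (μ L) x f) := by
    rw [SchrodingerLevi.translate_apply, SchrodingerLevi.translate_apply, translateFun_neg_apply]
  have hset : (fun u : Space L => u + -x) ⁻¹' (levelBall L k : Set (Space L)) = ballCoset L x k := by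
    ext u
    rw [Set.mem_preimage, mem_ballCoset_iff_sub_mem, SetLike.mem_coe, ← sub_eq_add_neg]
  rw [hback, hc, translate_indicatorConstLp,
    indicatorConstLp_congr_set hset _ _ (isOpen_ballCoset x k).measurableSet
      (isCompact_ballCoset x k).measure_lt_top.ne c,
    indicatorConstLp_eq_smul_indCO (isCompact_ballCoset x k) (isOpen_ballCoset x k)]

/-- the piece `P_{x + B_k} f` of a `τ(B_k)`-invariant class is a multiple of `1_{x + B_k}` -/
theorem exists_proj_ballCoset_eq_smul_indCO {f : Lp ℂ 2 (μ L)} {k : ℕ} (x : Space L)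
    (hτ : ∀ y ∈ levelBall L k, translate (μ L) y f = f) :
    ∃ c : ℂ, proj (μ L) (isOpen_ballCoset x k).measurableSet f =
      c • indCO L (ballCoset L x k) (isCompact_ballCoset x k) (isOpen_ballCoset x k) := by
  refine exists_eq_smul_indCO_of_translate_eq x (fun y hy => ?_) (ae_proj_eq_zero _ f)
  rw [translate_proj, hτ y hy]
  exact proj_congr_set (preimage_add_ballCoset hy) _ _ f

/-- **translation-smooth, compactly supported vectors are Schwartz–Bruhat.**  If `f ∈ L²(X)` is fixed by
the translations `τ_y`, `y ∈ B_k`, and vanishes (a.e.) off a compact set, then `f ∈ 𝒮(X)`: cover the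
support by finitely many level cosets `D`; `f = ∑_D P_D f` and each `P_D f = c_D • 1_D`. -/
theorem mem_schwartzBruhat_of_translate_eq {f : Lp ℂ 2 (μ L)} {k : ℕ}
    (hτ : ∀ y ∈ levelBall L k, translate (μ L) y f = f)
    {C : Set (Space L)} (hC : IsCompact C) (hsupp : ∀ᵐ u ∂(μ L), u ∉ C → f u = 0) :
    f ∈ schwartzBruhat L := by
  classical
  obtain ⟨t, -, hcover⟩ :=
    hC.elim_nhds_subcover (fun x => ballCoset L x k) fun x _ => ballCoset_mem_nhds x k
  set 𝒟 : Finset (Set (Space L)) := t.image fun x => ballCoset L x k with h𝒟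
  have h𝒟mem : ∀ D ∈ 𝒟, ∃ x, D = ballCoset L x k := fun D hD => by
    obtain ⟨x, -, rfl⟩ := Finset.mem_image.1 hD
    exact ⟨x, rfl⟩
  have hDm : ∀ D ∈ 𝒟, MeasurableSet D := fun D hD => by
    obtain ⟨x, rfl⟩ := h𝒟mem D hD
    exact (isOpen_ballCoset x k).measurableSet
  let piece : Set (Space L) → Lp ℂ 2 (μ L) := fun D =>
    if hD : MeasurableSet D then proj (μ L) hD f else 0
  have hpiece_def : ∀ D (hD : D ∈ 𝒟), piece D = proj (μ L) (hDm D hD) f := fun D hD => dif_pos (hDm D hD)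
  -- each piece lies in `𝒮(X)`
  have hpiece : ∀ D ∈ 𝒟, piece D ∈ schwartzBruhat L := fun D hD => by
    obtain ⟨x, rfl⟩ := h𝒟mem D hD
    rw [hpiece_def _ hD]
    obtain ⟨c, hc⟩ := exists_proj_ballCoset_eq_smul_indCO x hτ
    rw [hc]
    exact Submodule.smul_mem _ c
      (Submodule.subset_span ⟨⟨ballCoset L x k, isCompact_ballCoset x k, isOpen_ballCoset x k⟩, rfl⟩)
  -- `f` is the sum of its pieces
  have hsum : f = ∑ D ∈ 𝒟, piece D := by
    apply Lp.ext
    have hall : ∀ᵐ u ∂(μ L), ∀ D ∈ 𝒟, (piece D : Space L → ℂ) u = D.indicator (f : Space L → ℂ) u :=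
      (Filter.eventually_all_finset 𝒟).2 fun D hD => by
        rw [hpiece_def D hD]
        exact coeFn_proj (μ L) (hDm D hD) f
    filter_upwards [hall, hsupp, coeFn_finset_sum_Lp 𝒟 piece] with u hu hu0 hs
    rw [hs]
    by_cases huC : u ∈ ⋃ x ∈ t, ballCoset L x k
    · obtain ⟨x, hxt, hux⟩ := Set.mem_iUnion₂.1 huC
      have hD₀ : ballCoset L x k ∈ 𝒟 := Finset.mem_image.2 ⟨x, hxt, rfl⟩
      rw [Finset.sum_eq_single_of_mem (ballCoset L x k) hD₀ fun D hD hne => ?_]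
      · rw [hu _ hD₀, Set.indicator_of_mem hux]
      · rw [hu D hD, Set.indicator_of_notMem]
        intro huD
        obtain ⟨x', rfl⟩ := h𝒟mem D hD
        exact hne (ballCoset_eq_ballCoset_of_mem_of_mem huD hux)
    · have hfu : (f : Space L → ℂ) u = 0 := hu0 fun h => huC (hcover h)
      rw [Finset.sum_eq_zero fun D hD => ?_]
      · exact hfu
      · rw [hu D hD, Set.indicator_apply]
        split_ifs
        · exact hfu
        · rfl
  rw [hsum]
  exact Submodule.sum_mem _ hpiece

/-- **`𝒮(X)` = the translation-smooth compactly supported vectors**, as an iff. -/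
theorem mem_schwartzBruhat_iff_translate :
    ∀ {f : Lp ℂ 2 (μ L)}, f ∈ schwartzBruhat L ↔
      (∃ k, ∀ y ∈ levelBall L k, translate (μ L) y f = f) ∧
        ∃ C : Set (Space L), IsCompact C ∧ ∀ᵐ u ∂(μ L), u ∉ C → f u = 0 := by
  intro f
  constructor
  · intro hf
    refine ⟨exists_level_translate_eq hf, ?_⟩
    obtain ⟨g, hg, hfg⟩ := mem_schwartzBruhat_iff.1 hf
    refine ⟨tsupport g, hg.2, ?_⟩
    filter_upwards [hfg] with u hu huC
    rw [hu]
    exact image_eq_zero_of_notMem_tsupport huC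
  · rintro ⟨⟨k, hk⟩, C, hC, hsupp⟩
    exact mem_schwartzBruhat_of_translate_eq hk hC hsupp

/-! ## §3  The spherical vector -/

variable (L) in
/-- the level-`0` ball is the box `∏_v 𝒪_v³` -/
theorem coe_levelBall_zero : (levelBall L 0 : Set (Space L)) = (box L : Set (Space L)) := by
  ext u
  rw [SetLike.mem_coe, mem_levelBall_iff, mem_box_iff]
  refine forall_congr' fun i => ?_
  rw [rad_of_not_lt (Nat.not_lt_zero _), mem_cube_iff]

variable (L) in
/-- (Ported verbatim from the HodgeCMPerL package; no docstring in the source.) -/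
theorem ballCoset_zero_zero : ballCoset L 0 0 = (box L : Set (Space L)) := by
  rw [← coe_levelBall_zero]
  ext u
  rw [mem_ballCoset_iff_sub_mem, sub_zero, SetLike.mem_coe]

/-- **the spherical vector.**  An `L²(X)` class supported in `∏_v 𝒪_v³` and fixed by the translations
`τ_y`, `y ∈ ∏_v 𝒪_v³`, is a constant multiple of `φ⁰ = 1_{∏_v 𝒪_v³}`: up to scalars the distinguished
vector of the restricted tensor product `⊗'_v (L²((L⁺_v)³), 1_{𝒪_v³})` is the unique `∏_v 𝒪_v³`-spherical
vector living on `∏_v 𝒪_v³`. -/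
theorem exists_eq_smul_indCO_box {f : Lp ℂ 2 (μ L)}
    (hτ : ∀ y ∈ (box L : Set (Space L)), translate (μ L) y f = f)
    (hsupp : ∀ᵐ u ∂(μ L), u ∉ (box L : Set (Space L)) → f u = 0) :
    ∃ c : ℂ, f = c • indCO L (box L) (box L).isCompact (isOpen_box L) := by
  obtain ⟨c, hc⟩ := exists_eq_smul_indCO_of_translate_eq (k := 0) (0 : Space L)
    (fun y hy => hτ y (levelBall_subset_box L 0 hy))
    (by simpa only [ballCoset_zero_zero] using hsupp)
  exact ⟨c, hc.trans (by rw [indCO_congr_set (ballCoset_zero_zero L)])⟩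

/-! ## §4  Strong continuity of the translations on `L²(X)` -/

/-- **strong continuity of `y ↦ τ_y` on `L²(X)`**: for every `f`, `y ↦ τ_y f` is continuous `X → L²(X)`
(on the dense subspace `𝒮(X)` the orbit map is locally constant by §1; the `τ_y` are isometries). -/
theorem continuous_translate_apply (f : Lp ℂ 2 (μ L)) :
    Continuous fun y : Space L => translate (μ L) y f := by
  rw [continuous_iff_continuousAt]
  intro y₀
  rw [ContinuousAt, Metric.tendsto_nhds]
  intro ε hε
  obtain ⟨s, hs, hfs⟩ := (dense_schwartzBruhat (L := L)).exists_dist_lt (translate (μ L) y₀ f) (half_pos hε)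
  obtain ⟨k, hk⟩ := exists_level_translate_eq hs
  have hnhd : (fun y : Space L => y - y₀) ⁻¹' (levelBall L k : Set (Space L)) ∈ 𝓝 y₀ :=
    (continuous_sub_right y₀).continuousAt.preimage_mem_nhds
      (by simpa only [sub_self] using (isOpen_levelBall L k).mem_nhds (levelBall L k).zero_mem)
  filter_upwards [hnhd] with y hy
  rw [Set.mem_preimage, SetLike.mem_coe] at hy
  have hsplit : translate (μ L) y f = translate (μ L) (y - y₀) (translate (μ L) y₀ f) := by
    simp only [SchrodingerLevi.translate_apply]
    rw [translateFun_translateFun, sub_add_cancel]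
  rw [hsplit, dist_eq_norm]
  have heq : translate (μ L) (y - y₀) (translate (μ L) y₀ f) - translate (μ L) y₀ f =
      translate (μ L) (y - y₀) (translate (μ L) y₀ f - s) - (translate (μ L) y₀ f - s) := by
    rw [map_sub, hk _ hy]
    abel
  rw [heq, dist_eq_norm] at *
  calc ‖translate (μ L) (y - y₀) (translate (μ L) y₀ f - s) - (translate (μ L) y₀ f - s)‖
      ≤ ‖translate (μ L) (y - y₀) (translate (μ L) y₀ f - s)‖ + ‖translate (μ L) y₀ f - s‖ :=
        norm_sub_le _ _
    _ = ‖translate (μ L) y₀ f - s‖ + ‖translate (μ L) y₀ f - s‖ := by rw [LinearIsometryEquiv.norm_map]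
    _ < ε / 2 + ε / 2 := add_lt_add hfs hfs
    _ = ε := add_halves ε

end Coeff

end HodgeCM.PerL34.PureTensor.SchrodingerModel
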